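import Literature.NumberTheory.Sieve.Maynard2016Prop94ClassCount
import HarnessLib

/-!
# Maynard's Proposition 9.4: expansion of the majorant `λ̃₁⁻² 1_{(L₀(n),W)=1}(∑_{d₀∣L₀(n)} λ̃_{d₀})² · w_n`

Source: J. Maynard, *Dense clusters of primes in subsets*, Compositio Math. 152 (2016) =
arXiv:1405.2593 [Maynard2016DenseClusters], proof of Proposition 9.4 pp. 25–26: «we obtain an upper
bound by replacing the indicator of `L(n)` prime by the square of a one-dimensional sieve weight …
expanding the square and swapping the order of summation, counting `n` in residue classes».

With the one-dimensional square `g(n) = 1_{(L₀(n),W)=1} (∑_{d₀ ∈ box₀, d₀ ∣ L₀(n)} λ̃_{d₀})²`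
(`λ̃ = lamT M R₀`, `box₀ = box₀ M R₀`) and the `k`-dimensional weight `w_n = sieveWt`:
* `sum_oneDimSq_mul_sieveWt_eq`: `∑_{n∈S} g(n) w_n = ∑_{d,e ∈ 𝒟_k} ∑_{d₀,e₀ ∈ box₀} λ_dλ_eλ̃_{d₀}λ̃_{e₀} ·
  #{n ∈ S : (L_i(n),W)=1, d_i,e_i ∣ L_i(n) ∀i; (L₀(n),W)=1, d₀,e₀ ∣ L₀(n)}` (`sum_mul_sieveWt_eq` + the
  same expansion of `g`);
* `abs_sum_oneDimSq_mul_sieveWt_sub_le`: with the class count of `Maynard2016Prop94ClassCount`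
  (`W ∣ M`, `Δ_L ∣ M`, `𝓛` admissible),
  `|∑_{n∈𝒜(X)} g(n) w_n − #𝒜(X) (φ_{ω⁺}(W)/W) Q⁺| ≤ φ_{ω⁺}(W) (∑_d|λ_d|)² (∑_{d₀}|λ̃_{d₀}|)²`, where
  `Q⁺ = ∑_{(d,d₀),(e,e₀) cross-coprime} λ_dλ_eλ̃_{d₀}λ̃_{e₀}/([d₀,e₀]∏[d_i,e_i])` is the coupled quadratic form
  (evaluated in `Maynard2016Prop94QuadFormBound` after reindexing by the Option box);
* `indicator_prime_coprime_le`: the pointwise majorant `1_{L₀(n) prime > R₀} w ≤ λ̃₁⁻² g(n) w` once every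
  prime of `W` is `≤ R₀` (so that a prime `L₀(n) > R₀` is coprime to `W`).

## References
* J. Maynard, *Dense clusters of primes in subsets*, Compositio Math. 152 (2016), proof of Prop. 9.4
  pp. 25–26 [Maynard2016DenseClusters].
* K. Ford, B. Green, S. Konyagin, J. Maynard, T. Tao, *Long gaps between primes*, JAMS 31 (2018),
  Thm 6 (iii) (7.14) p. 22 [FordGreenKonyaginMaynardTao2018].
-/

open Finset

namespace Literature.NumberTheory.Sieve.FGKMT2018

variable {k : ℕ}

/-- **Expanding the one-dimensional square, pointwise**:
`1_{(x,W)=1}(∑_{d₀ ∈ box₀, d₀ ∣ x} λ̃_{d₀})² = ∑_{d₀,e₀ ∈ box₀} 1[(x,W)=1, d₀ ∣ x, e₀ ∣ x] λ̃_{d₀}λ̃_{e₀}`.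
[cite: Maynard2016DenseClusters, proof of Prop. 9.4 p. 26 («expanding the square»)] -/
theorem oneDimSq_eq_sum_sum (M : ℕ) (R₀ : ℝ) (W : ℕ) (x : ℤ) :
    (if Int.gcd x W = 1 then
        (∑ d₀ ∈ (SelbergBox.box₀ M R₀).filter (fun d₀ : ℕ => ((d₀ : ℕ) : ℤ) ∣ x),
          SelbergBox.lamT M R₀ d₀) ^ 2 else 0) =
      ∑ d₀ ∈ SelbergBox.box₀ M R₀, ∑ e₀ ∈ SelbergBox.box₀ M R₀,
        (if Int.gcd x W = 1 ∧ (((d₀ : ℕ) : ℤ) ∣ x ∧ ((e₀ : ℕ) : ℤ) ∣ x) then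
          SelbergBox.lamT M R₀ d₀ * SelbergBox.lamT M R₀ e₀ else 0) := by
  classical
  split_ifs with hc
  · rw [sq, Finset.sum_filter, Finset.sum_mul_sum]
    refine Finset.sum_congr rfl fun d₀ _ => Finset.sum_congr rfl fun e₀ _ => ?_
    by_cases hd : ((d₀ : ℕ) : ℤ) ∣ x <;> by_cases he : ((e₀ : ℕ) : ℤ) ∣ x <;> simp [hc, hd, he]
  · symm
    refine Finset.sum_eq_zero fun d₀ _ => Finset.sum_eq_zero fun e₀ _ => ?_
    rw [if_neg (fun h => hc h.1)]

/-- **Expanding both squares and swapping the sums**: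
`∑_{n∈S} g(n) w_n = ∑_{d,e ∈ 𝒟_k} ∑_{d₀,e₀ ∈ box₀} λ_dλ_e(λ̃_{d₀}λ̃_{e₀}) · #{n ∈ S : (L_i(n),W)=1, d_i,e_i ∣ L_i(n) ∀i; (L₀(n),W)=1, d₀,e₀ ∣ L₀(n)}`.
[cite: Maynard2016DenseClusters, proof of Prop. 9.4 p. 26; proof of Prop. 9.1 p. 19 (first display)] -/
theorem sum_oneDimSq_mul_sieveWt_eq (L : Fin k → ℤ × ℤ) (B : ℕ) (R : ℝ) (F : (Fin k → ℝ) → ℝ)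
    (S : Finset ℤ) (l₀ : ℤ × ℤ) (M : ℕ) (R₀ : ℝ) :
    ∑ n ∈ S, (if Int.gcd (formEval l₀ n) (wCut k B) = 1 then
        (∑ d₀ ∈ (SelbergBox.box₀ M R₀).filter (fun d₀ : ℕ => ((d₀ : ℕ) : ℤ) ∣ formEval l₀ n),
          SelbergBox.lamT M R₀ d₀) ^ 2 else 0) * sieveWt L B R F n =
      ∑ d ∈ dkBox L B R, ∑ e ∈ dkBox L B R,
        ∑ d₀ ∈ SelbergBox.box₀ M R₀, ∑ e₀ ∈ SelbergBox.box₀ M R₀,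
          lamVar L B R F d * lamVar L B R F e *
            (SelbergBox.lamT M R₀ d₀ * SelbergBox.lamT M R₀ e₀) *
            #(S.filter fun n : ℤ =>
              ((∀ i, Int.gcd (formEval (L i) n) (wCut k B) = 1) ∧
                  (∀ i, ((d i : ℕ) : ℤ) ∣ formEval (L i) n) ∧ ∀ i, ((e i : ℕ) : ℤ) ∣ formEval (L i) n) ∧
                (Int.gcd (formEval l₀ n) (wCut k B) = 1 ∧
                  (((d₀ : ℕ) : ℤ) ∣ formEval l₀ n ∧ ((e₀ : ℕ) : ℤ) ∣ formEval l₀ n))) := by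
  classical
  rw [sum_mul_sieveWt_eq]
  refine Finset.sum_congr rfl fun d _ => Finset.sum_congr rfl fun e _ => ?_
  -- expand g on the filtered set and swap
  have hg : ∀ S' : Finset ℤ,
      ∑ n ∈ S', (if Int.gcd (formEval l₀ n) (wCut k B) = 1 then
          (∑ d₀ ∈ (SelbergBox.box₀ M R₀).filter (fun d₀ : ℕ => ((d₀ : ℕ) : ℤ) ∣ formEval l₀ n),
            SelbergBox.lamT M R₀ d₀) ^ 2 else 0) =
        ∑ d₀ ∈ SelbergBox.box₀ M R₀, ∑ e₀ ∈ SelbergBox.box₀ M R₀,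
          SelbergBox.lamT M R₀ d₀ * SelbergBox.lamT M R₀ e₀ *
            #(S'.filter fun n : ℤ => Int.gcd (formEval l₀ n) (wCut k B) = 1 ∧
              (((d₀ : ℕ) : ℤ) ∣ formEval l₀ n ∧ ((e₀ : ℕ) : ℤ) ∣ formEval l₀ n)) := by
    intro S'
    simp_rw [oneDimSq_eq_sum_sum]
    rw [Finset.sum_comm]
    refine Finset.sum_congr rfl fun d₀ _ => ?_
    rw [Finset.sum_comm]
    refine Finset.sum_congr rfl fun e₀ _ => ?_
    rw [Finset.card_eq_sum_ones, Nat.cast_sum, Finset.mul_sum, Finset.sum_filter]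
    refine Finset.sum_congr rfl fun n _ => ?_
    split_ifs <;> simp
  rw [hg, Finset.mul_sum]
  refine Finset.sum_congr rfl fun d₀ _ => ?_
  rw [Finset.mul_sum]
  refine Finset.sum_congr rfl fun e₀ _ => ?_
  rw [Finset.filter_filter]
  ring

/-- **The majorant sum counted in residue classes** (`𝓛` admissible, `W ∣ M`, `Δ_L ∣ M`,
`W = ∏_{p ≤ 2k², p ∤ B} p`): with `g(n)` the one-dimensional square and
`Q⁺ = ∑_{cross-coprime (d,d₀),(e,e₀)} λ_dλ_e λ̃_{d₀}λ̃_{e₀}/([d₀,e₀] ∏_i [d_i,e_i])`,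
`|∑_{n∈𝒜(X)} g(n) w_n − #𝒜(X) (φ_{ω⁺}(W)/W) Q⁺| ≤ φ_{ω⁺}(W) (∑_d |λ_d|)² (∑_{d₀} |λ̃_{d₀}|)²`.
[cite: Maynard2016DenseClusters, proof of Prop. 9.4 p. 26 («counting n in residue classes … as in the proof of Proposition 9.1»), (9.1) p. 19] -/
theorem abs_sum_oneDimSq_mul_sieveWt_sub_le (X : ℝ) {L : Fin k → ℤ × ℤ} (hadm : FormsAdmissible L)
    (B : ℕ) (R : ℝ) (F : (Fin k → ℝ) → ℝ) (l₀ : ℤ × ℤ) {M : ℕ} (hWM : wCut k B ∣ M)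
    (hΔ : discDelta L l₀ ∣ M) (R₀ : ℝ) :
    |∑ n ∈ dyadZ X, (if Int.gcd (formEval l₀ n) (wCut k B) = 1 then
          (∑ d₀ ∈ (SelbergBox.box₀ M R₀).filter (fun d₀ : ℕ => ((d₀ : ℕ) : ℤ) ∣ formEval l₀ n),
            SelbergBox.lamT M R₀ d₀) ^ 2 else 0) * sieveWt L B R F n -
        (#(dyadZ X) : ℝ) * phiOmega (Fin.cons l₀ L : Fin (k + 1) → ℤ × ℤ) (wCut k B) / (wCut k B : ℝ) *
          ∑ d ∈ dkBox L B R, ∑ e ∈ dkBox L B R,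
            ∑ d₀ ∈ SelbergBox.box₀ M R₀, ∑ e₀ ∈ SelbergBox.box₀ M R₀,
              (if (∀ i j, i ≠ j → (d i * e i).Coprime (d j * e j)) ∧
                  ∀ i, (d₀ * e₀).Coprime (d i * e i) then
                lamVar L B R F d * lamVar L B R F e *
                    (SelbergBox.lamT M R₀ d₀ * SelbergBox.lamT M R₀ e₀) /
                  (((Nat.lcm d₀ e₀ : ℕ) : ℝ) * ∏ ι, ((Nat.lcm (d ι) (e ι) : ℕ) : ℝ))
              else 0)|
      ≤ phiOmega (Fin.cons l₀ L : Fin (k + 1) → ℤ × ℤ) (wCut k B) *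
          ((∑ d ∈ dkBox L B R, |lamVar L B R F d|) ^ 2 *
            (∑ d₀ ∈ SelbergBox.box₀ M R₀, |SelbergBox.lamT M R₀ d₀|) ^ 2) := by
  classical
  set φ := phiOmega (Fin.cons l₀ L : Fin (k + 1) → ℤ × ℤ) (wCut k B) with hφ_def
  set A : ℝ := (#(dyadZ X) : ℝ) with hA_def
  rw [sum_oneDimSq_mul_sieveWt_eq, Finset.mul_sum, ← Finset.sum_sub_distrib]
  -- termwise
  have hterm : ∀ d ∈ dkBox L B R, ∀ e ∈ dkBox L B R,
      ∀ d₀ ∈ SelbergBox.box₀ M R₀, ∀ e₀ ∈ SelbergBox.box₀ M R₀,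
      |lamVar L B R F d * lamVar L B R F e * (SelbergBox.lamT M R₀ d₀ * SelbergBox.lamT M R₀ e₀) *
            (#((dyadZ X).filter fun n : ℤ =>
              ((∀ i, Int.gcd (formEval (L i) n) (wCut k B) = 1) ∧
                  (∀ i, ((d i : ℕ) : ℤ) ∣ formEval (L i) n) ∧ ∀ i, ((e i : ℕ) : ℤ) ∣ formEval (L i) n) ∧
                (Int.gcd (formEval l₀ n) (wCut k B) = 1 ∧
                  (((d₀ : ℕ) : ℤ) ∣ formEval l₀ n ∧ ((e₀ : ℕ) : ℤ) ∣ formEval l₀ n))) : ℝ) -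
          A * φ / (wCut k B : ℝ) *
            (if (∀ i j, i ≠ j → (d i * e i).Coprime (d j * e j)) ∧
                ∀ i, (d₀ * e₀).Coprime (d i * e i) then
              lamVar L B R F d * lamVar L B R F e *
                  (SelbergBox.lamT M R₀ d₀ * SelbergBox.lamT M R₀ e₀) /
                (((Nat.lcm d₀ e₀ : ℕ) : ℝ) * ∏ ι, ((Nat.lcm (d ι) (e ι) : ℕ) : ℝ))
            else 0)| ≤
        |lamVar L B R F d| * |lamVar L B R F e| *
          (|SelbergBox.lamT M R₀ d₀| * |SelbergBox.lamT M R₀ e₀|) * φ := by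
    intro d hd e he d₀ hd₀ e₀ he₀
    have hc := abs_card_dyadZ_pairPlus_sub_ite_le X hadm hd he l₀ hWM hΔ hd₀ he₀
    have heq : lamVar L B R F d * lamVar L B R F e *
          (SelbergBox.lamT M R₀ d₀ * SelbergBox.lamT M R₀ e₀) *
            (#((dyadZ X).filter fun n : ℤ =>
              ((∀ i, Int.gcd (formEval (L i) n) (wCut k B) = 1) ∧
                  (∀ i, ((d i : ℕ) : ℤ) ∣ formEval (L i) n) ∧ ∀ i, ((e i : ℕ) : ℤ) ∣ formEval (L i) n) ∧
                (Int.gcd (formEval l₀ n) (wCut k B) = 1 ∧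
                  (((d₀ : ℕ) : ℤ) ∣ formEval l₀ n ∧ ((e₀ : ℕ) : ℤ) ∣ formEval l₀ n))) : ℝ) -
          A * φ / (wCut k B : ℝ) *
            (if (∀ i j, i ≠ j → (d i * e i).Coprime (d j * e j)) ∧
                ∀ i, (d₀ * e₀).Coprime (d i * e i) then
              lamVar L B R F d * lamVar L B R F e *
                  (SelbergBox.lamT M R₀ d₀ * SelbergBox.lamT M R₀ e₀) /
                (((Nat.lcm d₀ e₀ : ℕ) : ℝ) * ∏ ι, ((Nat.lcm (d ι) (e ι) : ℕ) : ℝ))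
            else 0) =
        lamVar L B R F d * lamVar L B R F e *
          (SelbergBox.lamT M R₀ d₀ * SelbergBox.lamT M R₀ e₀) *
          ((#((dyadZ X).filter fun n : ℤ =>
              ((∀ i, Int.gcd (formEval (L i) n) (wCut k B) = 1) ∧
                  (∀ i, ((d i : ℕ) : ℤ) ∣ formEval (L i) n) ∧ ∀ i, ((e i : ℕ) : ℤ) ∣ formEval (L i) n) ∧
                (Int.gcd (formEval l₀ n) (wCut k B) = 1 ∧
                  (((d₀ : ℕ) : ℤ) ∣ formEval l₀ n ∧ ((e₀ : ℕ) : ℤ) ∣ formEval l₀ n))) : ℝ) -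
            (if (∀ i j, i ≠ j → (d i * e i).Coprime (d j * e j)) ∧
                ∀ i, (d₀ * e₀).Coprime (d i * e i) then
              A * φ / ((wCut k B : ℝ) * (((Nat.lcm d₀ e₀ : ℕ) : ℝ) * ∏ ι, ((Nat.lcm (d ι) (e ι) : ℕ) : ℝ)))
            else 0)) := by
      split_ifs <;> ring
    rw [heq, abs_mul, abs_mul, abs_mul, abs_mul]
    have hφ0 : 0 ≤ φ := by rw [hφ_def, ← cast_prod_sub_omegaL]; positivity
    exact mul_le_mul_of_nonneg_left hc (by positivity)
  refine (Finset.abs_sum_le_sum_abs _ _).trans ?_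
  calc ∑ d ∈ dkBox L B R, |∑ e ∈ dkBox L B R, ∑ d₀ ∈ SelbergBox.box₀ M R₀,
          ∑ e₀ ∈ SelbergBox.box₀ M R₀, _ - A * φ / (wCut k B : ℝ) * ∑ e ∈ dkBox L B R,
            ∑ d₀ ∈ SelbergBox.box₀ M R₀, ∑ e₀ ∈ SelbergBox.box₀ M R₀, _|
      ≤ ∑ d ∈ dkBox L B R, ∑ e ∈ dkBox L B R, ∑ d₀ ∈ SelbergBox.box₀ M R₀,
          ∑ e₀ ∈ SelbergBox.box₀ M R₀,
            |lamVar L B R F d| * |lamVar L B R F e| *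
              (|SelbergBox.lamT M R₀ d₀| * |SelbergBox.lamT M R₀ e₀|) * φ := by
        refine Finset.sum_le_sum fun d hd => ?_
        rw [Finset.mul_sum, ← Finset.sum_sub_distrib]
        refine (Finset.abs_sum_le_sum_abs _ _).trans (Finset.sum_le_sum fun e he => ?_)
        rw [Finset.mul_sum, ← Finset.sum_sub_distrib]
        refine (Finset.abs_sum_le_sum_abs _ _).trans (Finset.sum_le_sum fun d₀ hd₀ => ?_)
        rw [Finset.mul_sum, ← Finset.sum_sub_distrib]
        exact (Finset.abs_sum_le_sum_abs _ _).trans (Finset.sum_le_sum fun e₀ he₀ =>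
          hterm d hd e he d₀ hd₀ e₀ he₀)
    _ = φ * ((∑ d ∈ dkBox L B R, |lamVar L B R F d|) ^ 2 *
          (∑ d₀ ∈ SelbergBox.box₀ M R₀, |SelbergBox.lamT M R₀ d₀|) ^ 2) := by
        rw [sq, sq, Finset.sum_mul_sum, Finset.sum_mul_sum, Finset.sum_mul, Finset.mul_sum]
        refine Finset.sum_congr rfl fun d _ => ?_
        rw [Finset.sum_mul, Finset.mul_sum]
        refine Finset.sum_congr rfl fun e _ => ?_
        rw [Finset.mul_sum, Finset.mul_sum]
        refine Finset.sum_congr rfl fun d₀ _ => ?_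
        rw [Finset.mul_sum, Finset.mul_sum]
        refine Finset.sum_congr rfl fun e₀ _ => ?_
        ring

/-- **The pointwise majorant with the coprimality indicator**: if every prime factor of `W` is `≤ R₀`
and `R₀ ≥ 1`, then for `w ≥ 0`,
`1_{x prime, x > R₀} w ≤ λ̃₁⁻² 1_{(x,W)=1} (∑_{d₀ ∈ box₀, d₀ ∣ x} λ̃_{d₀})² w` (a prime `x > R₀` is coprime to `W`).
[cite: Maynard2016DenseClusters, proof of Prop. 9.4 p. 25 («if L(n) is a prime > R₀ then the sum is λ̃₁»)] -/
theorem indicator_prime_coprime_le {M : ℕ} {R₀ : ℝ} (hR : 1 ≤ R₀) {W : ℕ}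
    (hW : ∀ p : ℕ, p.Prime → p ∣ W → (p : ℝ) ≤ R₀) (x : ℤ) {w : ℝ} (hw : 0 ≤ w) :
    (if 0 < x ∧ x.natAbs.Prime ∧ R₀ < (x : ℝ) then w else 0) ≤
      (SelbergBox.S0 M R₀)⁻¹ ^ 2 *
        (if Int.gcd x W = 1 then
          (∑ d₀ ∈ (SelbergBox.box₀ M R₀).filter (fun d₀ : ℕ => ((d₀ : ℕ) : ℤ) ∣ x),
            SelbergBox.lamT M R₀ d₀) ^ 2 else 0) * w := by
  by_cases hx : 0 < x ∧ x.natAbs.Prime ∧ R₀ < (x : ℝ)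
  · have hg : Int.gcd x W = 1 := by
      rw [Int.gcd_eq_natAbs, Int.natAbs_natCast]
      refine (Nat.Prime.coprime_iff_not_dvd hx.2.1).2 fun h => ?_
      have h1 := hW _ hx.2.1 h
      have h2 : ((x.natAbs : ℕ) : ℝ) = (x : ℝ) := by
        rw [Nat.cast_natAbs, Int.cast_abs, abs_of_pos (by exact_mod_cast hx.1)]
      linarith [hx.2.2]
    rw [if_pos hg]
    exact SelbergBox.indicator_prime_le hR x hw
  · rw [if_neg hx]
    have : 0 ≤ (if Int.gcd x W = 1 then
        (∑ d₀ ∈ (SelbergBox.box₀ M R₀).filter (fun d₀ : ℕ => ((d₀ : ℕ) : ℤ) ∣ x),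
          SelbergBox.lamT M R₀ d₀) ^ 2 else 0) := by
      split_ifs
      · positivity
      · exact le_rfl
    positivity

end Literature.NumberTheory.Sieve.FGKMT2018
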